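import Mathlib.Analysis.CStarAlgebra.Matrix
import Mathlib.LinearAlgebra.Matrix.ToLinearEquiv
import Literature.Analysis.OperatorTheory.ContractiveDeterminantalRepresentation
import Literature.Computability.AlgebraicComplexity.DeterminantalComplexity
import HarnessLib

/-!
# Contractive determinantal complexity; basic API of contractive determinantal representations

Topic `Literature/Analysis/OperatorTheory`; companion of `ContractiveDeterminantalRepresentation`
(which vendors the vocabulary of Grinshpan–Kaliuzhnyi-Verbovetskyi–Woerdeman,
*Norm-constrained determinantal representations of multivariable polynomials*, Complex Anal. Oper.
Theory 7 (2013) = arXiv:1208.2288 [GrinshpanKaliuzhnyiverbovetsWoerdeman2012]: `blockVar κ = Z_n`,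
`gkvwDet κ K = det (I − K Z_n)`, `IsContraction K`, `HasContractiveDetRepr p R`, `IsSemiStable`).
This file serves definition request D1 of route `ValiantsHypothesis/ContractivityPrice`
(`defn-HasContractiveDetRepr`): the size functional `cdc` and the API the route asked for.

## Contents

* `contractiveDetComplexity f` (`cdc f`): the least `R` with `HasContractiveDetRepr f R` — the
  route's name for the least `|n|` at which GKVW's set `𝒦_n(f)` of representing matrices
  (Rem. 3.9, home of the dual constant `α(f) = inf_n min_{K ∈ 𝒦_n(f)} ‖K‖`) contains a contraction.
  Locators (numbering of arXiv:1208.2288, whose text was read): the representation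
  `p(z) = det (I_{|n|} − K Z_n)` is the first display of §1 (eq. (1.1) there; the companion file
  calls it (1.4)); "`K` a contraction" is the constraint of §3 (Thm. 3.2, Cor. 3.3) and §5
  (Thms. 5.2, 5.6); the estimate `‖K‖ ≥ 1 / s(p)` is §3, between Rem. 3.4 and Rem. 3.5.
* **Bridges to the forms inlined by the route items.** The tree's notion is GKVW's normalised
  `p = det (I_R − K Z_n)` (so `p(0) = 1`, `HasContractiveDetRepr.eval_zero_eq_one`); the route items
  inline `p = C (p 0) · det (I_R + diag (X ∘ κ) · K)` (`PriceOfContractivity`) and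
  `p = C a · det (I_R + diag (X ∘ κ) · K)` (`ContractiveHardness`, `CdcSuperquadratic`). With
  `K ↦ −K` and Sylvester's identity (`gkvwDet_neg`):
  `hasContractiveDetRepr_iff_exists_one_add_diagonal_mul` (the form `p = det (I + diag (X ∘ κ) K)`),
  `hasContractiveDetRepr_iff_C_eval_zero_mul` and `hasContractiveDetRepr_iff_exists_C_mul`
  (the two inlined forms, for `p(0) = 1`), `hasContractiveDetRepr_normalize_iff` (the
  `PriceOfContractivity` form for general `p(0) ≠ 0` is the tree's notion for `p / p(0)`).
* **Stability certificate** (GKVW 2012, §3, after Rem. 3.4: `‖K‖ ≥ 1 / s(p)`):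
  `det_one_add_diagonal_mul_ne_zero`, `HasContractiveDetRepr.eval_ne_zero`,
  `HasContractiveDetRepr.isSemiStable` — a contractive representation forces `p ≠ 0` on the open
  unit polydisc.
* **Affine representations**: the pencil `I_R + diag (X ∘ κ) K` has affine entries, so
  `HasContractiveDetRepr f R → HasDetRepr f R`
  (`Literature.Computability.AlgebraicComplexity.HasDetRepr`) and `dc f ≤ cdc f`
  (`determinantalComplexity_le_contractiveDetComplexity`, when some contractive representation
  exists).
* **Padding** `K ↦ K ⊕ 0_c` (operator norm and determinant unchanged): `HasContractiveDetRepr.mono`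
  (nonempty `σ`, to colour the new rows), `hasContractiveDetRepr_iff_contractiveDetComplexity_le`.

## Design notes

* Junk values: `contractiveDetComplexity f = sInf ∅ = 0` when `f` has no contractive
  representation of any size (e.g. `f(0) ≠ 1`, or `f` vanishing somewhere on the open unit
  polydisc); it is genuinely `0` exactly for `f = 1` (`hasContractiveDetRepr_zero_iff`). Existence
  for every `p` with `p(0) = 1` and no zero on the closed polydisc is Grinshpan–Kaliuzhnyi-
  Verbovetskyi–Vinnikov–Woerdeman, Math. Z. 283 (2016) = arXiv:1503.06161, Thm. 3.1 (irreducible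
  `p`; products by block-diagonal sums) — not vendored here.
* The operator norm on matrices is Mathlib's scoped instance `Matrix.Norms.L2Operator`; statements
  go through `Matrix.toEuclideanCLM` (as `IsContraction` does) and proofs open the scope locally
  (`Matrix.l2_opNorm_toEuclideanCLM`, `Matrix.l2_opNorm_diagonal`).
* The inline forms are spelled exactly as in
  `Summits/ValiantsHypothesis/ValiantsHypothesis/Theses/ContractivityPrice.lean`
  (`K.map (fun a : ℂ => (MvPolynomial.C a : MvPolynomial σ ℂ))`, `Matrix.toEuclideanCLM (𝕜 := ℂ) K`).
-/

noncomputable section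

open MvPolynomial Matrix

namespace Literature.Analysis.OperatorTheory

variable {σ : Type*}

section Defs

/-- The **contractive determinantal complexity** `cdc f` of `f ∈ ℂ[X_j : j ∈ σ]`: the least size
`R = |n|` of a contractive determinantal representation `f = det (I_R − K Z_n)`, `‖K‖ ≤ 1`
(`HasContractiveDetRepr f R`). The name is the requesting route's; in GKVW 2012 this is the least
`|n|` for which the set `𝒦_n(f)` of representing `|n| × |n|` matrices (Rem. 3.9, where the dual
quantity `α(f) = inf_n min_{K ∈ 𝒦_n(f)} ‖K‖` is introduced) meets the closed unit ball. An `sInf`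
over `ℕ`: junk value `0` iff `f` has no contractive representation of any size (forced e.g. by
`f(0) ≠ 1` or by a zero of `f` in the open unit polydisc, `HasContractiveDetRepr.eval_ne_zero`);
genuinely `0` exactly for `f = 1`. [cite: GrinshpanKaliuzhnyiverbovetsWoerdeman2012, Rem. 3.9] -/
def contractiveDetComplexity (f : MvPolynomial σ ℂ) : ℕ :=
  sInf {R : ℕ | HasContractiveDetRepr f R}

end Defs

section API

/-- `contractiveDetComplexity f` unfolds to `sInf {R | HasContractiveDetRepr f R}`.
[cite: GrinshpanKaliuzhnyiverbovetsWoerdeman2012, Rem. 3.9] -/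
theorem contractiveDetComplexity_def (f : MvPolynomial σ ℂ) :
    contractiveDetComplexity f = sInf {R : ℕ | HasContractiveDetRepr f R} :=
  rfl

/-! ### Bridges between `det (I − K Z_n)` and the inlined forms `det (I + diag (X ∘ κ) K)` -/

/-- `‖−K‖ = ‖K‖`: `−K` is a contraction iff `K` is. [folklore] -/
theorem isContraction_neg_iff {R : ℕ} (K : Matrix (Fin R) (Fin R) ℂ) :
    IsContraction (-K) ↔ IsContraction K := by
  simp only [IsContraction, map_neg, norm_neg]

/-- `det (I_R − (−K) Z_n) = det (I_R + diag (X ∘ κ) · K)`: sign change and Sylvester's identity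
`det (I + K D) = det (I + D K)` (`Matrix.det_one_add_mul_comm`). [folklore] -/
theorem gkvwDet_neg {R : ℕ} (κ : Fin R → σ) (K : Matrix (Fin R) (Fin R) ℂ) :
    gkvwDet κ (-K) =
      (1 + Matrix.diagonal (fun i => MvPolynomial.X (κ i)) *
        K.map (fun a : ℂ => (MvPolynomial.C a : MvPolynomial σ ℂ))).det := by
  rw [gkvwDet_eq_det_one_sub_blockVar_mul, Matrix.map_neg _ (map_neg C), mul_neg, sub_neg_eq_add]
  rfl

/-- **The `+` form.** `HasContractiveDetRepr f R` iff `f = det (I_R + diag (X ∘ κ) · K)` for some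
`R × R` contraction `K` and colouring `κ` (replace `K` by `−K` in GKVW's `det (I − K Z_n)`).
[cite: GrinshpanKaliuzhnyiverbovetsWoerdeman2012, §1] -/
theorem hasContractiveDetRepr_iff_exists_one_add_diagonal_mul (f : MvPolynomial σ ℂ) (R : ℕ) :
    HasContractiveDetRepr f R ↔
      ∃ (K : Matrix (Fin R) (Fin R) ℂ) (κ : Fin R → σ), ‖Matrix.toEuclideanCLM (𝕜 := ℂ) K‖ ≤ 1 ∧
        f = (1 + Matrix.diagonal (fun i => MvPolynomial.X (κ i)) *
          K.map (fun a : ℂ => (MvPolynomial.C a : MvPolynomial σ ℂ))).det := by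
  constructor
  · rintro ⟨κ, K, hK, hf⟩
    have h := gkvwDet_neg κ (-K)
    rw [neg_neg] at h
    exact ⟨-K, κ, (isContraction_neg_iff K).mpr hK, by rw [hf, h]⟩
  · rintro ⟨K, κ, hK, hf⟩
    exact ⟨κ, -K, (isContraction_neg_iff K).mpr hK, by rw [hf, gkvwDet_neg]⟩

/-- Evaluating the pencil determinant: at a point `z`, `det (I + diag (X ∘ κ) · K)` becomes
`det (I + diag (z ∘ κ) · K)` (evaluation is a ring homomorphism and commutes with `det`).
[folklore] -/
theorem eval_det_one_add_diagonal_mul_map_C {n : Type*} [Fintype n] [DecidableEq n]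
    (K : Matrix n n ℂ) (κ : n → σ) (z : σ → ℂ) :
    MvPolynomial.eval z
        (1 + Matrix.diagonal (fun i => MvPolynomial.X (κ i)) *
          K.map (fun a : ℂ => (MvPolynomial.C a : MvPolynomial σ ℂ))).det =
      (1 + Matrix.diagonal (fun i => z (κ i)) * K).det := by
  rw [RingHom.map_det, map_add, map_one, map_mul, RingHom.mapMatrix_apply,
    RingHom.mapMatrix_apply, diagonal_map (map_zero _), Matrix.map_map]
  simp [Function.comp_def]

/-- A contractively represented polynomial is normalised: `f(0) = det I_R = 1` (GKVW's standing
assumption `p(0) = 1`). [cite: GrinshpanKaliuzhnyiverbovetsWoerdeman2012, §1] -/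
theorem HasContractiveDetRepr.eval_zero_eq_one {f : MvPolynomial σ ℂ} {R : ℕ}
    (h : HasContractiveDetRepr f R) : MvPolynomial.eval 0 f = 1 := by
  obtain ⟨K, κ, -, hf⟩ := (hasContractiveDetRepr_iff_exists_one_add_diagonal_mul f R).mp h
  rw [hf, eval_det_one_add_diagonal_mul_map_C]
  simp

/-- **Bridge to the form inlined in `PriceOfContractivity`** (for normalised `f`): if `f(0) = 1`,
`HasContractiveDetRepr f R` is literally `∃ K κ, ‖K‖ ≤ 1 ∧ f = C (f 0) · det (I_R + diag (X ∘ κ) K)`.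
[folklore] -/
theorem hasContractiveDetRepr_iff_C_eval_zero_mul {f : MvPolynomial σ ℂ}
    (h1 : MvPolynomial.eval 0 f = 1) (R : ℕ) :
    HasContractiveDetRepr f R ↔
      ∃ (K : Matrix (Fin R) (Fin R) ℂ) (κ : Fin R → σ), ‖Matrix.toEuclideanCLM (𝕜 := ℂ) K‖ ≤ 1 ∧
        f = MvPolynomial.C (MvPolynomial.eval 0 f) *
          (1 + Matrix.diagonal (fun i => MvPolynomial.X (κ i)) *
            K.map (fun a : ℂ => (MvPolynomial.C a : MvPolynomial σ ℂ))).det := by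
  simp only [h1, MvPolynomial.C_1, one_mul]
  exact hasContractiveDetRepr_iff_exists_one_add_diagonal_mul f R

/-- **Bridge to the form inlined in `ContractiveHardness` / `CdcSuperquadratic`** (for normalised
`f`): if `f(0) = 1`, `HasContractiveDetRepr f R` iff `f = C a · det (I_R + diag (X ∘ κ) K)` for SOME
constant `a` (necessarily `a = f(0) = 1`) and some contraction `K`. [folklore] -/
theorem hasContractiveDetRepr_iff_exists_C_mul {f : MvPolynomial σ ℂ}
    (h1 : MvPolynomial.eval 0 f = 1) (R : ℕ) :
    HasContractiveDetRepr f R ↔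
      ∃ (a : ℂ) (K : Matrix (Fin R) (Fin R) ℂ) (κ : Fin R → σ),
        ‖Matrix.toEuclideanCLM (𝕜 := ℂ) K‖ ≤ 1 ∧
        f = MvPolynomial.C a *
          (1 + Matrix.diagonal (fun i => MvPolynomial.X (κ i)) *
            K.map (fun a : ℂ => (MvPolynomial.C a : MvPolynomial σ ℂ))).det := by
  rw [hasContractiveDetRepr_iff_exists_one_add_diagonal_mul]
  constructor
  · rintro ⟨K, κ, hK, hf⟩
    exact ⟨1, K, κ, hK, by rw [MvPolynomial.C_1, one_mul]; exact hf⟩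
  · rintro ⟨a, K, κ, hK, hf⟩
    have ha : a = 1 := by
      have h0 := congrArg (MvPolynomial.eval 0) hf
      rw [h1, map_mul, eval_C, eval_det_one_add_diagonal_mul_map_C] at h0
      simpa using h0.symm
    refine ⟨K, κ, hK, ?_⟩
    rw [hf, ha, MvPolynomial.C_1, one_mul]

/-- **Bridge to the form inlined in `PriceOfContractivity`, general `f(0) ≠ 0`.** The inlined
predicate `∃ K κ, ‖K‖ ≤ 1 ∧ f = C (f 0) · det (I_R + diag (X ∘ κ) K)` is the tree's (normalised)
notion for `f / f(0)`. [folklore] -/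
theorem hasContractiveDetRepr_normalize_iff {f : MvPolynomial σ ℂ}
    (h0 : MvPolynomial.eval 0 f ≠ 0) (R : ℕ) :
    HasContractiveDetRepr (MvPolynomial.C (MvPolynomial.eval 0 f)⁻¹ * f) R ↔
      ∃ (K : Matrix (Fin R) (Fin R) ℂ) (κ : Fin R → σ), ‖Matrix.toEuclideanCLM (𝕜 := ℂ) K‖ ≤ 1 ∧
        f = MvPolynomial.C (MvPolynomial.eval 0 f) *
          (1 + Matrix.diagonal (fun i => MvPolynomial.X (κ i)) *
            K.map (fun a : ℂ => (MvPolynomial.C a : MvPolynomial σ ℂ))).det := by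
  rw [hasContractiveDetRepr_iff_exists_one_add_diagonal_mul]
  refine exists_congr fun K => exists_congr fun κ => and_congr_right fun _ => ?_
  set c := MvPolynomial.eval 0 f with hc
  have hcc : (MvPolynomial.C c : MvPolynomial σ ℂ) * MvPolynomial.C c⁻¹ = 1 := by
    rw [← map_mul, mul_inv_cancel₀ h0, MvPolynomial.C_1]
  have hcc' : (MvPolynomial.C c⁻¹ : MvPolynomial σ ℂ) * MvPolynomial.C c = 1 := by
    rw [mul_comm, hcc]
  constructor
  · intro h
    calc f = MvPolynomial.C c * (MvPolynomial.C c⁻¹ * f) := by rw [← mul_assoc, hcc, one_mul]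
      _ = _ := by rw [h]
  · intro h
    rw [h, ← mul_assoc, hcc', one_mul]

/-! ### The stability certificate -/

open scoped Matrix.Norms.L2Operator in
/-- The pencil `I + diag d · K` is invertible when `‖K‖ ≤ 1` and all `|d_i| < 1`: a kernel vector
`v` would satisfy `v = −diag d · K v`, so `‖v‖ ≤ ‖d‖_∞ ‖v‖ < ‖v‖`. This is the estimate
`‖K‖ ≥ 1 / s(p)` of GKVW 2012, §3 (after Rem. 3.4).
[cite: GrinshpanKaliuzhnyiverbovetsWoerdeman2012, §3] -/
theorem det_one_add_diagonal_mul_ne_zero {𝕜 : Type*} [RCLike 𝕜] {n : Type*} [Fintype n]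
    [DecidableEq n] (K : Matrix n n 𝕜) (hK : ‖Matrix.toEuclideanCLM (𝕜 := 𝕜) K‖ ≤ 1) (d : n → 𝕜)
    (hd : ∀ i, ‖d i‖ < 1) : (1 + Matrix.diagonal d * K).det ≠ 0 := by
  intro hdet
  obtain ⟨v, hv0, hv⟩ := Matrix.exists_mulVec_eq_zero_iff.mpr hdet
  set T := Matrix.toEuclideanCLM (n := n) (𝕜 := 𝕜) K with hT
  set D := Matrix.toEuclideanCLM (n := n) (𝕜 := 𝕜) (Matrix.diagonal d) with hD
  have hDlt : ‖D‖ < 1 := by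
    rw [hD, Matrix.l2_opNorm_toEuclideanCLM, Matrix.l2_opNorm_diagonal]
    exact (pi_norm_lt_iff zero_lt_one).mpr hd
  set w : EuclideanSpace 𝕜 n := WithLp.toLp 2 v with hw
  have hw0 : w ≠ 0 := by simpa [hw] using hv0
  have h1 : v + Matrix.diagonal d *ᵥ (K *ᵥ v) = 0 := by
    simpa [Matrix.add_mulVec, Matrix.mulVec_mulVec] using hv
  have h2 : w + D (T w) = 0 := by
    apply WithLp.ofLp_injective 2
    simpa [hw, hD, hT] using h1
  have h3 : ‖w‖ ≤ ‖D‖ * ‖w‖ := by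
    calc ‖w‖ = ‖-(D (T w))‖ := congrArg (‖·‖) (eq_neg_of_add_eq_zero_left h2)
      _ = ‖D (T w)‖ := norm_neg _
      _ ≤ ‖D‖ * ‖T w‖ := D.le_opNorm _
      _ ≤ ‖D‖ * (‖T‖ * ‖w‖) := by gcongr; exact T.le_opNorm _
      _ ≤ ‖D‖ * (1 * ‖w‖) := by gcongr
      _ = ‖D‖ * ‖w‖ := by rw [one_mul]
  have h4 : ‖D‖ * ‖w‖ < ‖w‖ := mul_lt_of_lt_one_left (norm_pos_iff.mpr hw0) hDlt
  exact absurd (h3.trans_lt h4) (lt_irrefl _)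

/-- **A contractive determinantal representation certifies semi-stability**: if
`f = det (I_R − K Z_n)` with `‖K‖ ≤ 1` then `f(z) ≠ 0` whenever all `|z_j| < 1`
(GKVW 2012, §3: `‖K‖ ≥ 1 / s(p)`). [cite: GrinshpanKaliuzhnyiverbovetsWoerdeman2012, §3] -/
theorem HasContractiveDetRepr.eval_ne_zero {f : MvPolynomial σ ℂ} {R : ℕ}
    (h : HasContractiveDetRepr f R) {z : σ → ℂ} (hz : ∀ j, ‖z j‖ < 1) :
    MvPolynomial.eval z f ≠ 0 := by
  obtain ⟨K, κ, hK, hf⟩ := (hasContractiveDetRepr_iff_exists_one_add_diagonal_mul f R).mp h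
  rw [hf, eval_det_one_add_diagonal_mul_map_C]
  exact det_one_add_diagonal_mul_ne_zero K hK _ fun i => hz (κ i)

/-- In the vocabulary of `ContractiveDeterminantalRepresentation`: a contractively represented
polynomial is semi-stable (no zero in the open unit polydisc; GKVW 2012, §3).
[cite: GrinshpanKaliuzhnyiverbovetsWoerdeman2012, §3] -/
theorem HasContractiveDetRepr.isSemiStable [Fintype σ] {f : MvPolynomial σ ℂ} {R : ℕ}
    (h : HasContractiveDetRepr f R) : IsSemiStable f :=
  fun _ hz => h.eval_ne_zero hz

/-! ### Affine determinantal representations and `dc ≤ cdc` -/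

/-- The entries of the pencil `I + diag (X ∘ κ) · K` are affine linear forms
`δ_{ij} + K_{ij} X_{κ i}`. [folklore] -/
theorem totalDegree_one_add_diagonal_mul_map_C_apply_le {n : Type*} [Fintype n] [DecidableEq n]
    (K : Matrix n n ℂ) (κ : n → σ) (i j : n) :
    ((1 + Matrix.diagonal (fun i => MvPolynomial.X (κ i)) *
        K.map (fun a : ℂ => (MvPolynomial.C a : MvPolynomial σ ℂ)) :
          Matrix n n (MvPolynomial σ ℂ)) i j).totalDegree ≤ 1 := by
  rw [Matrix.add_apply, Matrix.diagonal_mul, Matrix.map_apply]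
  refine (totalDegree_add _ _).trans (max_le ?_ ?_)
  · rw [Matrix.one_apply]
    split_ifs <;> simp
  · calc (X (κ i) * C (K i j) : MvPolynomial σ ℂ).totalDegree
          ≤ (X (κ i) : MvPolynomial σ ℂ).totalDegree +
              (C (K i j) : MvPolynomial σ ℂ).totalDegree := totalDegree_mul _ _
      _ = 1 := by rw [totalDegree_X, totalDegree_C]

/-- A contractive determinantal representation of size `R` is in particular an affine
determinantal representation of size `R` (`Literature.Computability.AlgebraicComplexity.HasDetRepr`,
Mignon–Ressayre): the pencil `I_R + diag (X ∘ κ) · K` has affine entries. [folklore] -/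
theorem HasContractiveDetRepr.hasDetRepr {f : MvPolynomial σ ℂ} {R : ℕ}
    (h : HasContractiveDetRepr f R) :
    Literature.Computability.AlgebraicComplexity.HasDetRepr f R := by
  obtain ⟨K, κ, -, hf⟩ := (hasContractiveDetRepr_iff_exists_one_add_diagonal_mul f R).mp h
  exact ⟨_, totalDegree_one_add_diagonal_mul_map_C_apply_le K κ, hf.symm⟩

/-- Hence `dc f ≤ R` for every contractive determinantal representation of size `R`. [folklore] -/
theorem determinantalComplexity_le_of_hasContractiveDetRepr {f : MvPolynomial σ ℂ} {R : ℕ}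
    (h : HasContractiveDetRepr f R) :
    Literature.Computability.AlgebraicComplexity.determinantalComplexity f ≤ R :=
  Literature.Computability.AlgebraicComplexity.determinantalComplexity_le_of_hasDetRepr h.hasDetRepr

/-- Size `0`: the empty determinant is `1`, so exactly `f = 1` has a contractive representation of
size `0` (whence `cdc 1 = 0` genuinely). [folklore] -/
theorem hasContractiveDetRepr_zero_iff (f : MvPolynomial σ ℂ) :
    HasContractiveDetRepr f 0 ↔ f = 1 := by
  constructor
  · intro h
    obtain ⟨K, κ, -, hf⟩ := (hasContractiveDetRepr_iff_exists_one_add_diagonal_mul f 0).mp h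
    rw [hf, Matrix.det_fin_zero]
  · rintro rfl
    exact hasContractiveDetRepr_one Fin.elim0

/-! ### Padding and the infimum -/

/-- **Padding.** A contractive representation of size `R` gives one of every size `R' ≥ R`:
replace `K` by the block-diagonal `K ⊕ 0_c` (same operator norm;
`det (I + diag (X ∘ κ') (K ⊕ 0)) = det (I + diag (X ∘ κ) K) · det I_c`), colouring the `c` new rows
by an arbitrary variable — whence the hypothesis `Nonempty σ`. [folklore] -/
theorem HasContractiveDetRepr.mono [Nonempty σ] {f : MvPolynomial σ ℂ} {R R' : ℕ}
    (h : HasContractiveDetRepr f R) (hRR' : R ≤ R') : HasContractiveDetRepr f R' := by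
  classical
  obtain ⟨K, κ, hK, hf⟩ := (hasContractiveDetRepr_iff_exists_one_add_diagonal_mul f R).mp h
  obtain ⟨c, rfl⟩ := Nat.exists_eq_add_of_le hRR'
  set e : Fin R ⊕ Fin c ≃ Fin (R + c) := finSumFinEquiv with he
  set K' : Matrix (Fin (R + c)) (Fin (R + c)) ℂ :=
    Matrix.reindex e e (Matrix.fromBlocks K 0 0 0) with hK'
  set κ' : Fin (R + c) → σ := fun i => Sum.elim κ (fun _ => Classical.arbitrary σ) (e.symm i)
    with hκ'
  refine (hasContractiveDetRepr_iff_exists_one_add_diagonal_mul f (R + c)).mpr ⟨K', κ', ?_, ?_⟩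
  · -- the operator norm of `K ⊕ 0` is at most that of `K`
    refine ContinuousLinearMap.opNorm_le_bound _ zero_le_one fun x => ?_
    have hx1 : ‖Matrix.toEuclideanCLM (n := Fin R) (𝕜 := ℂ) K
        (WithLp.toLp 2 fun a => x (e (Sum.inl a)))‖ ≤
          ‖WithLp.toLp 2 fun a => x (e (Sum.inl a))‖ := by
      refine (ContinuousLinearMap.le_opNorm _ _).trans ?_
      exact mul_le_of_le_one_left (norm_nonneg _) hK
    rw [one_mul]
    rw [← sq_le_sq₀ (norm_nonneg _) (norm_nonneg _), EuclideanSpace.norm_sq_eq,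
      EuclideanSpace.norm_sq_eq] at hx1 ⊢
    rw [← e.sum_comp, ← e.sum_comp, Fintype.sum_sum_type, Fintype.sum_sum_type]
    have hmv : ∀ s, (K' *ᵥ (WithLp.ofLp x)) (e s) =
        Sum.elim (K *ᵥ fun a => x (e (Sum.inl a))) 0 s := by
      intro s
      rw [hK', Matrix.reindex_apply, Matrix.submatrix_mulVec_equiv, Function.comp_apply,
        Equiv.symm_symm, Equiv.symm_apply_apply, Matrix.fromBlocks_mulVec]
      simp only [Matrix.zero_mulVec, add_zero]
      rfl
    simp only [Matrix.ofLp_toEuclideanCLM, hmv, Sum.elim_inl, Sum.elim_inr, Pi.zero_apply,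
      norm_zero, ne_eq, OfNat.ofNat_ne_zero, not_false_eq_true, zero_pow, Finset.sum_const_zero,
      add_zero] at hx1 ⊢
    exact hx1.trans (le_add_of_nonneg_right (Finset.sum_nonneg fun _ _ => by positivity))
  · -- the determinant is unchanged
    have hmat : (1 + Matrix.diagonal (fun i => MvPolynomial.X (κ' i)) *
          K'.map (fun a : ℂ => (MvPolynomial.C a : MvPolynomial σ ℂ))) =
        Matrix.reindex e e (Matrix.fromBlocks
          (1 + Matrix.diagonal (fun i => MvPolynomial.X (κ i)) *
            K.map (fun a : ℂ => (MvPolynomial.C a : MvPolynomial σ ℂ))) 0 0 1) := by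
      ext i j
      obtain ⟨x, rfl⟩ := e.surjective i
      obtain ⟨y, rfl⟩ := e.surjective j
      simp only [hK', hκ', Matrix.reindex_apply, Matrix.submatrix_apply, Equiv.symm_apply_apply,
        Matrix.add_apply, Matrix.diagonal_mul, Matrix.map_apply, Matrix.one_apply,
        EmbeddingLike.apply_eq_iff_eq]
      rcases x with a | a <;> rcases y with b | b <;>
        simp [Matrix.fromBlocks, Matrix.one_apply, Matrix.diagonal_mul]
    rw [hmat, Matrix.det_reindex_self, Matrix.det_fromBlocks_zero₂₁, Matrix.det_one, mul_one]
    exact hf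

/-- Padding without `Nonempty σ` as an instance: if `R ≠ 0` the colouring itself exhibits a
variable. [folklore] -/
theorem HasContractiveDetRepr.mono' {f : MvPolynomial σ ℂ} {R R' : ℕ}
    (h : HasContractiveDetRepr f R) (hR : R ≠ 0) (hRR' : R ≤ R') : HasContractiveDetRepr f R' := by
  have ⟨κ, _⟩ := h
  haveI : Nonempty σ := ⟨κ ⟨0, Nat.pos_of_ne_zero hR⟩⟩
  exact h.mono hRR'

/-- If `f` has a contractive determinantal representation of size `R` then `cdc f ≤ R`
(GKVW 2012, §3). [cite: GrinshpanKaliuzhnyiverbovetsWoerdeman2012, §3] -/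
theorem contractiveDetComplexity_le_of_hasContractiveDetRepr {f : MvPolynomial σ ℂ} {R : ℕ}
    (h : HasContractiveDetRepr f R) : contractiveDetComplexity f ≤ R :=
  Nat.sInf_le h

/-- The contractive determinantal complexity is attained as soon as some contractive
representation exists (GKVW 2012, §3). [cite: GrinshpanKaliuzhnyiverbovetsWoerdeman2012, §3] -/
theorem hasContractiveDetRepr_contractiveDetComplexity {f : MvPolynomial σ ℂ}
    (h : ∃ R, HasContractiveDetRepr f R) :
    HasContractiveDetRepr f (contractiveDetComplexity f) :=
  Nat.sInf_mem h

/-- **`dc f ≤ cdc f`** as soon as `f` has some contractive determinantal representation (without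
existence `cdc f = 0` is junk and the bound is void). [folklore] -/
theorem determinantalComplexity_le_contractiveDetComplexity {f : MvPolynomial σ ℂ}
    (h : ∃ R, HasContractiveDetRepr f R) :
    Literature.Computability.AlgebraicComplexity.determinantalComplexity f ≤
      contractiveDetComplexity f :=
  determinantalComplexity_le_of_hasContractiveDetRepr (hasContractiveDetRepr_contractiveDetComplexity h)

/-- For nonempty `σ`, once a contractive representation exists, `HasContractiveDetRepr f R` holds
exactly for `R ≥ cdc f`. [folklore] -/
theorem hasContractiveDetRepr_iff_contractiveDetComplexity_le [Nonempty σ] {f : MvPolynomial σ ℂ}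
    (h : ∃ R, HasContractiveDetRepr f R) (R : ℕ) :
    HasContractiveDetRepr f R ↔ contractiveDetComplexity f ≤ R :=
  ⟨contractiveDetComplexity_le_of_hasContractiveDetRepr,
    fun hR => (hasContractiveDetRepr_contractiveDetComplexity h).mono hR⟩

end API

end Literature.Analysis.OperatorTheory
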